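import Literature.NumberTheory.LFunctions.XiPrimitive
import Literature.NumberTheory.LFunctions.XiIntegralWintnerProofs
import HarnessLib

/-!
# Wintner 1947 for `xiPrimitive`: `Im ξ^{(-1)}(½ + it) > 0` for `t > 0` — discharged

Sibling proofs file (D-0014 append protocol) of `Literature/NumberTheory/LFunctions/XiPrimitive.lean`,
discharging its named fact `Literature.NumberTheory.LFunctions.Wintner1947_im_xiPrimitive_pos`
[LagariasMontague2011, Thm. 2.1 (2) for `λ = 0`, credited there (§2.1, §4) to Wintner, Math. Notae 7
(1947)]: `Im ξ^{(-1)}(½ + it) > 0` for every `t > 0`, where `ξ^{(-1)}(s) = ∫_{1/2}^{s} ξ(w) dw` is realised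
along the segment (`Literature.NumberTheory.LFunctions.xiPrimitive`).

Two grounders vendored Lagarias–Montague 2011 concurrently (`XiPrimitive.lean`: `xiPrimitive`;
`XiIntegral.lean`: `xiIntegral`), and `xiPrimitive = xiIntegral` holds by `rfl`
(`Literature.NumberTheory.LFunctions.xiPrimitive_eq_xiIntegral`, `XiIntegralBridge.lean`). The full proof
— Riemann's cosine representation `ξ(½ + ix) = 8∫₀^∞ Φ(v) cos(2xv) dv` (the tree's
`deBruijnH_zero_eq_holds`), Fubini, the strict decrease of `Φ(v)/v` on `(0, ∞)` (termwise), and Wintner's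
pairing Claim of LM §4 — is `Literature/NumberTheory/LFunctions/XiIntegralWintnerProofs.lean`
(`Literature.NumberTheory.LFunctions.Wintner1947_xiIntegral_im_pos_holds`); this file transports it, and the
two corollaries a user of `xiPrimitive` wants, across the definitional identification. (An independent
proof along the same lines, written for this file before the twin landed, is kept in the seat folder and
not duplicated here.)

Nothing new is asserted: theorems only, no definitions, no named facts.

## References

* J. C. Lagarias, D. Montague, *The integral of the Riemann ξ-function*, Comment. Math. Univ. St.
  Pauli 60 (2011), 143–169; arXiv:1106.4348 — §2.1, Thm. 2.1 (2), eq. (1.4), §4 (proof of Thm. 2.1 (2)).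
  [LagariasMontague2011]
* A. Wintner, *On an oscillatory property of the Riemann Ξ-function*, Math. Notae 7 (1947), 177–178.
  [Wintner1947]
-/

noncomputable section

open Complex MeasureTheory Set

namespace Literature.NumberTheory.LFunctions

/-- DISCHARGE of the named fact `Literature.NumberTheory.LFunctions.Wintner1947_im_xiPrimitive_pos`
(**Wintner 1947**; Lagarias–Montague 2011, Thm. 2.1 (2) for `λ = 0`, §2.1 and §4: "Wintner [Wi47] proved
that `Ξ₀^{(-1)}(t) > 0` when `t > 0`"): `Im ξ^{(-1)}(½ + it) > 0` for every `t > 0`. It is the twin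
statement `Wintner1947_xiIntegral_im_pos` (proved in `XiIntegralWintnerProofs.lean`) read through
`xiPrimitive = xiIntegral` (`rfl`). [cite: LagariasMontague2011, Thm. 2.1 (2)] -/
theorem Wintner1947_im_xiPrimitive_pos_holds : Wintner1947_im_xiPrimitive_pos :=
  Wintner1947_xiIntegral_im_pos_holds

/-- `Im ξ^{(-1)}(½ + it) = 4 ∫₀^∞ (Φ(v)/v) sin(2tv) dv` for `t ≠ 0`, `Φ = deBruijnPhi` (Rodgers–Tao
normalisation; Lagarias–Montague's `Ξ₀^{(-1)}(t) = 2∫₀^∞ Φ_LM(u) (sin tu)/u du` with `Φ_LM(u) = 2Φ(u/2)`),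
for `xiPrimitive`. [cite: LagariasMontague2011, eq. (1.4)] -/
theorem im_xiPrimitive_half_add_mul_I_eq {t : ℝ} (ht : t ≠ 0) :
    (xiPrimitive (1 / 2 + t * I)).im =
      4 * ∫ v in Ioi (0 : ℝ), deBruijnPhi v / v * Real.sin (2 * t * v) :=
  im_xiIntegral_eq ht

/-- **Lagarias–Montague 2011, Thm. 2.1 (2)** (`λ = 0`) for `xiPrimitive`: on the critical line
`ξ^{(-1)}(½ + it) = 0 ↔ t = 0` ("`ξ^{(-1)}(s)` has no zeros on the critical line except for a zero at
`s = ½`", LM §2.1), i.e. the tree's `LagariasMontague2011_thm_2_1_ii_holds` read through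
`xiPrimitive = xiIntegral`. [cite: LagariasMontague2011, Thm. 2.1 (2)] -/
theorem xiPrimitive_half_add_mul_I_eq_zero_iff (t : ℝ) :
    xiPrimitive (1 / 2 + t * I) = 0 ↔ t = 0 :=
  LagariasMontague2011_thm_2_1_ii_holds t

/-- Hence `s = ½` is the only zero of `ξ^{(-1)}` on the critical line: for `Re s = ½`,
`ξ^{(-1)}(s) = 0 ↔ s = ½`. [cite: LagariasMontague2011, Thm. 2.1 (2)] -/
theorem xiPrimitive_eq_zero_iff_of_re_eq_half {s : ℂ} (hs : s.re = 1 / 2) :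
    xiPrimitive s = 0 ↔ s = 1 / 2 := by
  have hs' : s = 1 / 2 + (s.im : ℂ) * I := by
    apply Complex.ext <;> simp [hs]
  rw [hs', xiPrimitive_half_add_mul_I_eq_zero_iff]
  constructor
  · intro h; simp [h]
  · intro h
    have := congrArg Complex.im h
    simpa using this

end Literature.NumberTheory.LFunctions
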